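import Summits.KontsevichZagierPeriods.KontsevichZagierPeriods.Theorems.TerasomaMultiplicationBetaCancellationStubTameFormAux7

/-!
# `BetaCancellation` (stmt-KontsevichZagierPeriods-13633), line `divisor-slicing-transshipment` — stub `stub_tameForm`, auxiliary file 8: elementary shadows and rule (1a)

Formal combinations whose `K₀`-shadow vanishes by IDENTITY pieces (no analysis): `[r] − [r']` for
representations with the same domain and integrands agreeing on it; `[r]` for a representation with
zero integrand or with null domain; `[r] + [r']` for opposite integrands on a common domain; and
`[r] − ∑ₖ [Rₖ]` for a finite almost-partition of the domain of `r` by subrepresentations `Rₖ`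
(domains inside that of `r`, carrying its integrand, pairwise a.e. disjoint, covering a.e.). The last
one contains **rule (1a)** (additivity in the domain): every element of `KZ.domainAddRel` has
vanishing shadow.

References: M. Kontsevich, D. Zagier, *Periods* (2001), §1.2 rule (1); crux NOTES c6 (F13).
-/

noncomputable section

-- `Summit.KontsevichZagierPeriods.KontsevichZagierPeriods.…` is the tree's mandated layout (single-conjunct summit).
set_option linter.dupNamespace false

namespace Summit.KontsevichZagierPeriods.KontsevichZagierPeriods.BetaCancellationDivisorSlicing

open MeasureTheory Set Function
open Literature.NumberTheory.Transcendental
open Literature.NumberTheory.Transcendental.KZ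
open Literature.ModelTheory.ExponentialFields (IsSemialgebraic isSemialgebraic_univ)

variable {n : ℕ}

/-- Lifting to the same dimension does nothing to sets. [folklore] -/
@[simp] theorem liftSet_self (s : Set (Fin n → ℝ)) : liftSet n s = s := by
  rw [liftSet_eq le_rfl, stabSet_rfl]

/-- Lifting to the same dimension does nothing to functions. [folklore] -/
@[simp] theorem liftFun_self (f : (Fin n → ℝ) → ℝ) : liftFun n f = f := by
  rw [liftFun_eq le_rfl, stabFun_rfl]

/-- Lifting commutes with negation (this moves the negation outside, to a non-dependent type).
[folklore] -/
@[simp] theorem liftFun_neg (N : ℕ) (f : (Fin n → ℝ) → ℝ) : liftFun N (-f) = -liftFun N f := by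
  by_cases h : n ≤ N
  · rw [liftFun_eq h, liftFun_eq h]
    rfl
  · simp only [liftFun, dif_neg h, neg_zero]

namespace Shadow

/-- **Congruent representations**: same domain, integrands agreeing on it — `[r] − [r']` has
vanishing shadow (identity pieces `{f>0} → {f'>0}`, `{f'<0} → {f<0}`). [folklore] -/
theorem of_eqOn {r r' : IntegralRep n} (hd : r'.domain = r.domain)
    (h : EqOn r.integrand r'.integrand r.domain) : Nonempty (Shadow (of r - of r')) := by
  have hpos : posSet r = posSet r' := by
    ext x; simp only [mem_posSet, hd]
    exact ⟨fun hx => ⟨hx.1, h hx.1 ▸ hx.2⟩, fun hx => ⟨hx.1, (h hx.1).symm ▸ hx.2⟩⟩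
  have hneg : negSet r' = negSet r := by
    ext x; simp only [mem_negSet, hd]
    exact ⟨fun hx => ⟨hx.1, (h hx.1) ▸ hx.2⟩, fun hx => ⟨hx.1, (h hx.1).symm ▸ hx.2⟩⟩
  refine ⟨⟨1, 1, fun _ => ⟨n, r⟩, fun _ => ⟨n, r'⟩, by simp, n, fun _ => le_rfl, fun _ => le_rfl,
    Classical.choice ?_⟩⟩
  refine MIso.of_idPieces (P₀ := Unit ⊕ Unit) (Sum.map (fun _ => 0) (fun _ => 0))
    (Sum.map (fun _ => 0) (fun _ => 0)) (Sum.elim (fun _ => posSet r) (fun _ => negSet r')) ?_ ?_ ?_ ?_ ?_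
  · rintro (_ | _)
    · refine ⟨isSemialgebraic_posSet r, ?_, ?_, ?_⟩
      · simp
      · simp [hpos]
      · intro x hx
        simp only [Sum.map_inl, Sum.elim_inl, liftFun_self]
        exact h hx.1
    · refine ⟨isSemialgebraic_negSet r', ?_, ?_, ?_⟩
      · simp
      · simp [hneg]
      · intro x hx
        simp only [Sum.map_inr, Sum.elim_inr, liftFun_self, Pi.neg_apply, neg_inj]
        exact (h (hd ▸ hx.1)).symm
  · rintro (_ | _) (_ | _) hne hst <;> first | exact (hne rfl).elim | simp at hst
  · rintro (_ | _) (_ | _) hne hst <;> first | exact (hne rfl).elim | simp at hst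
  · rintro (i | j)
    · refine measure_mono_null (fun z hz => ?_) measure_empty
      simp only [Set.mem_sdiff, mem_iUnion, exists_prop, not_exists, not_and, Sum.elim_inl,
        liftSet_self] at hz
      exact hz.2 (Sum.inl ()) (by simp [Subsingleton.elim i 0]) hz.1
    · refine measure_mono_null (fun z hz => ?_) measure_empty
      simp only [Set.mem_sdiff, mem_iUnion, exists_prop, not_exists, not_and, Sum.elim_inr,
        liftSet_self] at hz
      exact hz.2 (Sum.inr ()) (by simp [Subsingleton.elim j 0]) hz.1
  · rintro (j | i)
    · refine measure_mono_null (fun z hz => ?_) measure_empty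
      simp only [Set.mem_sdiff, mem_iUnion, exists_prop, not_exists, not_and, Sum.elim_inl,
        liftSet_self] at hz
      exact hz.2 (Sum.inl ()) (by simp [Subsingleton.elim j 0]) (hpos ▸ hz.1)
    · refine measure_mono_null (fun z hz => ?_) measure_empty
      simp only [Set.mem_sdiff, mem_iUnion, exists_prop, not_exists, not_and, Sum.elim_inr,
        liftSet_self] at hz
      exact hz.2 (Sum.inr ()) (by simp [Subsingleton.elim i 0]) (hneg.symm ▸ hz.1)

/-- **Zero integrand**: `[r]` has vanishing shadow (both parts are empty). [folklore] -/
theorem of_eqOn_zero (r : IntegralRep n) (h : EqOn r.integrand 0 r.domain) :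
    Nonempty (Shadow (of r)) := by
  have hpos : posSet r = ∅ := by
    ext x; simp only [mem_posSet, mem_empty_iff_false, iff_false, not_and, not_lt]
    exact fun hx => (h hx).le
  have hneg : negSet r = ∅ := by
    ext x; simp only [mem_negSet, mem_empty_iff_false, iff_false, not_and, not_lt]
    exact fun hx => (h hx).ge
  refine ⟨⟨1, 0, fun _ => ⟨n, r⟩, Fin.elim0, by simp, n, fun _ => le_rfl, fun j => j.elim0,
    Classical.choice ?_⟩⟩
  refine MIso.of_idPieces (P₀ := Empty) Empty.elim Empty.elim Empty.elim (fun p => p.elim)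
    (fun p => p.elim) (fun p => p.elim) ?_ ?_
  · rintro (i | j)
    · simp [hpos]
    · exact j.elim0
  · rintro (j | i)
    · exact j.elim0
    · simp [hneg]

/-- **Null domain**: `[r]` has vanishing shadow (both parts are null). [folklore] -/
theorem of_volume_zero (r : IntegralRep n) (h : volume r.domain = 0) :
    Nonempty (Shadow (of r)) := by
  refine ⟨⟨1, 0, fun _ => ⟨n, r⟩, Fin.elim0, by simp, n, fun _ => le_rfl, fun j => j.elim0,
    Classical.choice ?_⟩⟩
  refine MIso.of_idPieces (P₀ := Empty) Empty.elim Empty.elim Empty.elim (fun p => p.elim)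
    (fun p => p.elim) (fun p => p.elim) ?_ ?_
  · rintro (i | j)
    · simpa using measure_mono_null (fun x (hx : x ∈ posSet r) => hx.1) h
    · exact j.elim0
  · rintro (j | i)
    · exact j.elim0
    · simpa using measure_mono_null (fun x (hx : x ∈ negSet r) => hx.1) h

/-- **Opposite integrands** on a common domain: `[r] + [r']` has vanishing shadow (identity pieces
`{f>0} → {f'<0}`, `{f'>0} → {f<0}`). [folklore] -/
theorem of_neg_pair {r r' : IntegralRep n} (hd : r'.domain = r.domain)
    (h : EqOn r'.integrand (-r.integrand) r.domain) : Nonempty (Shadow (of r + of r')) := by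
  have h1 : posSet r = negSet r' := by
    ext x; simp only [mem_posSet, mem_negSet, hd]
    refine ⟨fun hx => ⟨hx.1, ?_⟩, fun hx => ⟨hx.1, ?_⟩⟩
    · rw [h hx.1]; simpa using hx.2
    · have := hx.2; rw [h hx.1] at this; simpa using this
  have h2 : posSet r' = negSet r := by
    ext x; simp only [mem_posSet, mem_negSet, hd]
    refine ⟨fun hx => ⟨hx.1, ?_⟩, fun hx => ⟨hx.1, ?_⟩⟩
    · have := hx.2; rw [h hx.1] at this; simpa using this
    · rw [h hx.1]; simpa using hx.2
  refine ⟨⟨2, 0, ![⟨n, r⟩, ⟨n, r'⟩], Fin.elim0, by simp, n, fun i => ?_, fun j => j.elim0,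
    Classical.choice ?_⟩⟩
  · fin_cases i <;> exact le_rfl
  refine MIso.of_idPieces (P₀ := Fin 2) (fun p => Sum.inl p) (fun p => Sum.inr (1 - p))
    ![posSet r, posSet r'] ?_ ?_ ?_ ?_ ?_
  · intro p
    fin_cases p
    · refine ⟨isSemialgebraic_posSet r, by simp, by simp [h1], fun x hx => ?_⟩
      have hx' : x ∈ posSet r := by simpa using hx
      have := h hx'.1
      simp only [Fin.zero_eta, Fin.isValue, Sum.elim_inl, Matrix.cons_val_zero, liftFun_self,
        sub_zero, Sum.elim_inr, liftFun_neg, Matrix.cons_val_one,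
        Pi.neg_apply]
      rw [this, Pi.neg_apply, neg_neg]
    · refine ⟨isSemialgebraic_posSet r', by simp, by simp [h2], fun x hx => ?_⟩
      have hx' : x ∈ posSet r' := by simpa using hx
      have := h (hd ▸ hx'.1)
      simp only [Fin.mk_one, Fin.isValue, Sum.elim_inl, Matrix.cons_val_one,
        liftFun_self, sub_self, Sum.elim_inr, liftFun_neg, Matrix.cons_val_zero, Pi.neg_apply]
      rw [this, Pi.neg_apply]
  · intro p p' hne h
    exact absurd (Sum.inl_injective h) hne
  · intro p p' hne h
    have : (1 : Fin 2) - p = 1 - p' := Sum.inr_injective h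
    exact absurd (sub_right_injective this) hne
  · rintro (i | j)
    · refine measure_mono_null (fun z hz => ?_) measure_empty
      simp only [Set.mem_sdiff, mem_iUnion, exists_prop, not_exists, not_and] at hz
      refine hz.2 i rfl ?_
      have := hz.1
      fin_cases i <;> simpa using this
    · exact j.elim0
  · rintro (j | i)
    · exact j.elim0
    · refine measure_mono_null (fun z hz => ?_) measure_empty
      simp only [Set.mem_sdiff, mem_iUnion, exists_prop, not_exists, not_and] at hz
      refine hz.2 (1 - i) (by fin_cases i <;> rfl) ?_
      have := hz.1
      fin_cases i
      · simpa [h2] using this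
      · simpa [h1] using this

/-- **Finite almost-partitions**: if the `Rₖ` have domains inside that of `r`, carry its integrand,
are pairwise a.e. disjoint and cover the domain of `r` a.e., then `[r] − ∑ₖ [Rₖ]` has vanishing
shadow (identity pieces between the parts). [folklore] -/
theorem of_partition {K : ℕ} (r : IntegralRep n) (R : Fin K → IntegralRep n)
    (hsub : ∀ k, (R k).domain ⊆ r.domain)
    (hint : ∀ k, EqOn (R k).integrand r.integrand (R k).domain)
    (hdisj : ∀ k k', k ≠ k' → volume ((R k).domain ∩ (R k').domain) = 0)
    (hcov : volume (r.domain \ ⋃ k, (R k).domain) = 0) :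
    Nonempty (Shadow (of r - ∑ k, of (R k))) := by
  have hposk : ∀ k, posSet (R k) ⊆ posSet r := fun k x hx =>
    ⟨hsub k hx.1, by rw [← hint k hx.1]; exact hx.2⟩
  have hnegk : ∀ k, negSet (R k) ⊆ negSet r := fun k x hx =>
    ⟨hsub k hx.1, by rw [← hint k hx.1]; exact hx.2⟩
  refine ⟨⟨1, K, fun _ => ⟨n, r⟩, fun k => ⟨n, R k⟩, by simp, n, fun _ => le_rfl, fun _ => le_rfl,
    Classical.choice ?_⟩⟩
  refine MIso.of_idPieces (P₀ := Fin K ⊕ Fin K) (Sum.map (fun _ => 0) id) (Sum.map id (fun _ => 0))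
    (Sum.elim (fun k => posSet (R k)) (fun k => negSet (R k))) ?_ ?_ ?_ ?_ ?_
  · rintro (k | k)
    · refine ⟨isSemialgebraic_posSet _, by simpa using hposk k, by simp, fun x hx => ?_⟩
      simp only [Sum.map_inl, Sum.elim_inl, liftFun_self, id_eq]
      exact (hint k hx.1).symm
    · refine ⟨isSemialgebraic_negSet _, by simp, by simpa using hnegk k, fun x hx => ?_⟩
      simp only [Sum.map_inr, Sum.elim_inr, liftFun_self, id_eq, Pi.neg_apply, neg_inj]
      exact hint k hx.1
  · rintro (k | k) (k' | k') hne h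
    · have hkk : k ≠ k' := fun h' => hne (by rw [h'])
      exact measure_mono_null (inter_subset_inter (posSet_subset _) (posSet_subset _))
        (hdisj k k' hkk)
    · simp at h
    · simp at h
    · simp only [Sum.map_inr, Sum.inr.injEq] at h
      exact absurd (congrArg Sum.inr h) hne
  · rintro (k | k) (k' | k') hne h
    · simp only [Sum.map_inl, id_eq, Sum.inl.injEq] at h
      exact absurd (congrArg Sum.inl h) hne
    · simp at h
    · simp at h
    · have hkk : k ≠ k' := fun h' => hne (by rw [h'])
      exact measure_mono_null (inter_subset_inter (negSet_subset _) (negSet_subset _))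
        (hdisj k k' hkk)
  · rintro (i | k)
    · refine measure_mono_null (fun x hx => ?_) hcov
      simp only [Set.mem_sdiff, mem_iUnion, exists_prop, not_exists, not_and, Sum.elim_inl,
        liftSet_self] at hx ⊢
      refine ⟨hx.1.1, fun k hk => hx.2 (Sum.inl k) (by simp [Subsingleton.elim i 0]) ?_⟩
      exact ⟨hk, by rw [hint k hk]; exact hx.1.2⟩
    · refine measure_mono_null (fun x hx => ?_) measure_empty
      simp only [Set.mem_sdiff, mem_iUnion, exists_prop, not_exists, not_and, Sum.elim_inr,
        liftSet_self] at hx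
      exact hx.2 (Sum.inr k) (by simp) hx.1
  · rintro (k | i)
    · refine measure_mono_null (fun x hx => ?_) measure_empty
      simp only [Set.mem_sdiff, mem_iUnion, exists_prop, not_exists, not_and, Sum.elim_inl,
        liftSet_self] at hx
      exact hx.2 (Sum.inl k) (by simp) hx.1
    · refine measure_mono_null (fun x hx => ?_) hcov
      simp only [Set.mem_sdiff, mem_iUnion, exists_prop, not_exists, not_and, Sum.elim_inr,
        liftSet_self] at hx ⊢
      refine ⟨hx.1.1, fun k hk => hx.2 (Sum.inr k) (by simp [Subsingleton.elim i 0]) ?_⟩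
      exact ⟨hk, by rw [hint k hk]; exact hx.1.2⟩

/-- **Rule (1a), additivity in the domain, has vanishing shadow.**
[cite: KontsevichZagier2001, §1.2 rule (1)] -/
theorem of_mem_domainAddRel {c : FormalRep} (hc : c ∈ domainAddRel) : Nonempty (Shadow c) := by
  obtain ⟨n, r, r₁, r₂, hdom, hnull, h₁, h₂, rfl⟩ := hc
  obtain ⟨S⟩ := of_partition r ![r₁, r₂] (fun k => by
      fin_cases k
      · simp [hdom]
      · simp [hdom])
    (fun k => by
      fin_cases k
      · simpa using h₁.symm
      · simpa using h₂.symm)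
    (fun k k' hkk => by
      fin_cases k <;> fin_cases k'
      · exact absurd rfl hkk
      · simpa using hnull
      · simpa [inter_comm] using hnull
      · exact absurd rfl hkk)
    (by
      refine measure_mono_null (fun x hx => ?_) measure_empty
      simp only [Set.mem_sdiff, mem_iUnion, not_exists, hdom] at hx
      rcases hx.1 with h | h
      · exact hx.2 0 (by simpa using h)
      · exact hx.2 1 (by simpa using h))
  exact S.congr (by simp [Fin.sum_univ_two]; abel)

end Shadow

/-! ### Headline -/

/-- Registered helper goal of the stub `stub_tameForm`: rule (1a) (additivity in the domain) has
vanishing `K₀`-shadow. [cite: KontsevichZagier2001, §1.2 rule (1)] -/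
theorem tameForm_aux_shadowDomainAdd : ∀ c ∈ domainAddRel, Nonempty (Shadow c) :=
  fun _ hc => Shadow.of_mem_domainAddRel hc

end Summit.KontsevichZagierPeriods.KontsevichZagierPeriods.BetaCancellationDivisorSlicing

end
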